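import Literature.MathematicalPhysics.QuantumFieldTheory.ConformalBootstrap3D.PointKernelK34L505Data
import Literature.MathematicalPhysics.QuantumFieldTheory.ConformalBootstrap3D.PointKernelK34L505Segs
import Literature.MathematicalPhysics.QuantumFieldTheory.ConformalBootstrap3D.PointKernelParts

/-!
# K34L505 certificate, kernel part file P50: one-cell head segments 113, 114 in level ranges

The head cells whose kernel evaluation exceeds one `decide` are one-cell segments of `hsegsK34L505`; each is
checked by `PCert.hPartSideOK` (side conditions) and `PCert.hPartOK` per level range `[n_lo, n_lo + count)`
against an integer claim, the claims summing to `≥ 0` (`PointKernel.partsOK`); soundness is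
`PCert.hParts_sound` (`PointKernelParts`).  The part files are mutually independent (each imports only
the data file); the ranges of one cell may span several of them, and the per-cell conclusions
`hparts_i` / `hcell_i` of those cells are assembled in `PointKernelK34L505.lean`.
Estimated kernel time 222 s.
-/

set_option maxRecDepth 100000
set_option maxHeartbeats 0

namespace Literature.MathematicalPhysics.QuantumFieldTheory.ConformalBootstrap3D.PointKernelK34L505

open Literature.MathematicalPhysics.QuantumFieldTheory.ConformalBootstrap3D.PointKernel

/-- levels `[0, 31)` of segment 113: partial lower sum `≥` claim. [folklore] -/
theorem part_113_0 : certK34L505.hPartOK (PCert.segAt hsegsK34L505 113) JHK34L505 0 31 (-13238960989944121935495598279865306046) = true := by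
  decide +kernel

/-- levels `[31, 44)` of segment 113: partial lower sum `≥` claim. [folklore] -/
theorem part_113_1 : certK34L505.hPartOK (PCert.segAt hsegsK34L505 113) JHK34L505 31 13 (11879010185434860092845855658535307088) = true := by
  decide +kernel

/-- levels `[44, 49)` of segment 113: partial lower sum `≥` claim. [folklore] -/
theorem part_113_2 : certK34L505.hPartOK (PCert.segAt hsegsK34L505 113) JHK34L505 44 5 (1359950804509261842649742621329998960) = true := by
  decide +kernel

/-- one-cell segment 114 (row 6, cell `[1797/256, 899/128]`, chord, `n_F = 56`,
4 level ranges): side conditions. [folklore] -/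
theorem pside_114 : certK34L505.hPartSideOK (PCert.segAt hsegsK34L505 114) JHK34L505 = true := by
  decide +kernel

/-- its level ranges `(n_lo, count, claim)`. [folklore] -/
def partsK34L505_114 : List (ℕ × ℕ × ℤ) := [(0, 30, -15525046202321698683528655816839418898), (30, 13, 12571568116449570941321995141125225922), (43, 9, 2530004411261926884644050752716596252), (52, 5, 423473674610200857562609922997596725)]

/-- the ranges tile `[0, n_F]` and the claims sum to `≥ 0`. [folklore] -/
theorem pcov_114 : PointKernel.partsOK 56 partsK34L505_114 = true := by
  decide +kernel

/-- levels `[0, 30)` of segment 114: partial lower sum `≥` claim. [folklore] -/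
theorem part_114_0 : certK34L505.hPartOK (PCert.segAt hsegsK34L505 114) JHK34L505 0 30 (-15525046202321698683528655816839418898) = true := by
  decide +kernel

end Literature.MathematicalPhysics.QuantumFieldTheory.ConformalBootstrap3D.PointKernelK34L505
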